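import Mathlib
import Summits.ValiantsHypothesis.ValiantsHypothesis.Theorems.LacunarySymmetroidMatrixDescartesFlagTwoStepKit

/-!
# `MatrixDescartes` (stmt-ValiantsHypothesis-18050) — THE TWO-STEP FLAG AT INFINITY: with a SINGULAR top letter `S_{l₁}` and
# a unique second letter `S_{l₂}`, for large `x` the pencil `Σ_l x^{d_l}S_l` has
# `ν = ν(S_{l₁}) + ν(S_{l₂}|ker S_{l₁})`, `π = π(S_{l₁}) + π(S_{l₂}|ker S_{l₁})`, provided the compression is non-singular

HONEST FRAMING.  Cell `pub-symmetroid`, seat `val-sym-mdr-p2` (gen 21); helper file `--supports` the crux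
`Theses.LacunarySymmetroid.MatrixDescartes` (OPEN), NO closure claim; assembles the kit `…FlagTwoStepKit` into the theorem.
Extends the tree's END INERTIA LAW `Inertia.eventually_atTop_indices_eq` (non-singular top letter) by one flag step;
general bookkeeping for the inertia calculus on pencils whose extreme letters are degenerate.  Nothing here bears on the
crux in its window, `stub_twoSided`, `DoorA26` / `DoorA34`, registers, or `VP ≠ VNP`.

SETTING (as in the kit).  Real symmetric letters `S_l`, unique top exponent `d_{l₁}`, unique second exponent
`d_{l₂} < d_{l₁}` (all other `d_l < d_{l₂}`), `U` the eigenvector matrix of `S_{l₁}`, `Z = {i : λᵢ = 0}`,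
`D = (UᵀS_{l₂}U)|_{Z×Z}` the compression of `S_{l₂}` to `ker S_{l₁}`.

* `indices_conj_eq` — congruence by an invertible matrix preserves both indices (rectangular Sylvester both ways).
* **`flag_twoStep_indices_eq` (THE TWO-STEP FLAG AT INFINITY).**  If `det D ≠ 0` then there is `N` with, for all
  `x ≥ N`: `ν(F(x)) = ν(S_{l₁}) + ν(D)`, `π(F(x)) = π(S_{l₁}) + π(D)`, `det F(x) ≠ 0` (`F(x) = Σ_l x^{d_l}S_l`).  Mechanism:
  `F(x) = x^{d_{l₁}}G(s)` at `s = 1/√x`, `UᵀG(s)U` is diagonally congruent to the polynomial family `K(s)` whose value at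
  `0` is `D ⊕ diag(λ|_{Zᶜ})`, non-singular, so its indices are locally constant.  With `S_{l₁}` non-singular `Z = ∅` and
  this is the tree's end-inertia law; the flag at `0⁺` is the same statement for the reflected exponents.

[folklore] (Sylvester's law of inertia; continuity of the spectrum).  Axioms `propext`, `Classical.choice`, `Quot.sound`.
No definitions.
-/

-- layout Summits/ValiantsHypothesis/ValiantsHypothesis forces the duplicated namespace component
set_option linter.dupNamespace false

namespace Summit.ValiantsHypothesis.ValiantsHypothesis.Theorems.LacunarySymmetroidMatrixDescartes

open Polynomial Matrix Finset
open scoped BigOperators Topology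

namespace Inertia

section FlagTwoStep

variable {m K : ℕ} (d : Fin K → ℕ) (S : Fin K → Matrix (Fin m) (Fin m) ℝ) (hS : ∀ l, (S l).IsHermitian) (l₁ l₂ : Fin K)

/-- the eigenvector matrix of the top letter (file-local notation) -/
local notation3 (prettyPrint := false) "𝕌₁" => ((hS l₁).eigenvectorUnitary : Matrix (Fin m) (Fin m) ℝ)

/-- the eigenvalues of the top letter (file-local notation) -/
local notation3 (prettyPrint := false) "λ₁" => (hS l₁).eigenvalues

/-- the gap `g = d_{l₁} − d_{l₂}` (file-local notation) -/
local notation3 (prettyPrint := false) "𝕘" => (d l₁ - d l₂)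

/-- the exponent of `s` at entry `(i, j)` of letter `l` in the rescaled family (file-local notation) -/
local notation3 (prettyPrint := false) "𝕟[" l ", " i ", " j "]" =>
  (2 * (d l₁ - d l) - (if λ₁ i = 0 then 𝕘 else 0) - (if λ₁ j = 0 then 𝕘 else 0))

/-- the polynomial family `K(s)` (file-local notation) -/
local notation3 (prettyPrint := false) "𝕂[" s "]" =>
  (Matrix.of fun (i j : Fin m) => (if i = j then λ₁ i else 0)
    + ∑ l ∈ Finset.univ.erase l₁, (s : ℝ) ^ (𝕟[l, i, j]) * ((𝕌₁)ᵀ * S l * 𝕌₁) i j)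

/-- the rescaled pencil `G(s) = Σ_l s^{2(d_{l₁} − d_l)} S_l` (file-local notation) -/
local notation3 (prettyPrint := false) "𝔾[" s "]" => (∑ l, (s : ℝ) ^ (2 * (d l₁ - d l)) • S l)

/-- the compression of `S_{l₂}` to `ker S_{l₁}` in the eigenbasis (file-local notation) -/
local notation3 (prettyPrint := false) "𝔻" =>
  (((𝕌₁)ᵀ * S l₂ * 𝕌₁).submatrix (fun i : {i : Fin m // λ₁ i = 0} => i.1) (fun i : {i : Fin m // λ₁ i = 0} => i.1))

/-! ## §4  The two-step flag at infinity -/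

/-- Congruence by an invertible matrix preserves both indices (rectangular Sylvester both ways). [folklore] -/
theorem indices_conj_eq {A : Matrix (Fin m) (Fin m) ℝ} (hA : A.IsHermitian) (W W' : Matrix (Fin m) (Fin m) ℝ)
    (hB : (Wᵀ * A * W).IsHermitian) (hinv : W'ᵀ * (Wᵀ * A * W) * W' = A) :
    Fintype.card {j // hB.eigenvalues j < 0} = Fintype.card {j // hA.eigenvalues j < 0}
      ∧ Fintype.card {j // 0 < hB.eigenvalues j} = Fintype.card {j // 0 < hA.eigenvalues j} := by
  have hA' : (W'ᵀ * (Wᵀ * A * W) * W').IsHermitian := by rw [hinv]; exact hA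
  constructor
  · refine le_antisymm (GramDual.negIndex_conj_le hA W hB) ?_
    have h := GramDual.negIndex_conj_le hB W' hA'
    rwa [negIndex_congr hA' hA hinv] at h
  · refine le_antisymm (GramDual.posIndex_conj_le hA W hB) ?_
    have h := GramDual.posIndex_conj_le hB W' hA'
    rwa [posIndex_congr hA' hA hinv] at h

/-- **THE TWO-STEP FLAG AT INFINITY.**  Real symmetric letters, unique top exponent `d_{l₁}`, unique second exponent
`d_{l₂}` (all other exponents `< d_{l₂}`), and the compression `D` of `S_{l₂}` to `ker S_{l₁}` (in the eigenbasis of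
`S_{l₁}`) NON-SINGULAR.  Then for all large `x` the evaluated pencil `F(x) = Σ_l x^{d_l}S_l` has
`ν(F(x)) = ν(S_{l₁}) + ν(D)`, `π(F(x)) = π(S_{l₁}) + π(D)`, and `det F(x) ≠ 0`. [folklore] -/
theorem flag_twoStep_indices_eq (h12 : d l₂ < d l₁) (hsec : ∀ l, l ≠ l₁ → l ≠ l₂ → d l < d l₂) (hDu : IsUnit (𝔻).det)
    (hSs : ∀ l, (S l).IsSymm) :
    ∃ N : ℝ, 0 < N ∧ ∀ x : ℝ, N ≤ x →
      Fintype.card {j // (isHermitian_pencil d S hSs x).eigenvalues j < 0}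
          = Fintype.card {j // (hS l₁).eigenvalues j < 0} + Fintype.card {j // (isHermitian_compression S hS l₁ l₂).eigenvalues j < 0}
        ∧ Fintype.card {j // 0 < (isHermitian_pencil d S hSs x).eigenvalues j}
          = Fintype.card {j // 0 < (hS l₁).eigenvalues j} + Fintype.card {j // 0 < (isHermitian_compression S hS l₁ l₂).eigenvalues j}
        ∧ (∑ l, x ^ d l • S l).det ≠ 0 := by
  classical
  have hle : ∀ l, d l ≤ d l₁ := fun l => by
    by_cases h1 : l = l₁
    · rw [h1]
    · by_cases h2 : l = l₂
      · rw [h2]; exact h12.le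
      · exact ((hsec l h1 h2).trans h12).le
  -- local constancy of the indices of `K` at the non-singular point `0`
  set Kf : ℝ → Matrix (Fin m) (Fin m) ℝ := fun s => 𝕂[s] with hKf
  have hKH : ∀ s, (Kf s).IsHermitian := fun s => isHermitian_K d S hS l₁ l₂ s
  have hcont : ∀ i j, Continuous fun s => Kf s i j := continuous_K d S hS l₁ l₂
  have hdet0 : (Kf 0).det ≠ 0 := det_K_zero_ne_zero d S hS l₁ l₂ h12 hsec hDu
  obtain ⟨hν0, hπ0⟩ := indices_K_zero d S hS l₁ l₂ h12 hsec hDu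
  have hcnt0 := (negIndex_add_posIndex_add_corank (hKH 0)).1
  rw [corank_eq_zero_of_det_ne_zero hdet0, add_zero] at hcnt0
  have hev := (eventually_negIndex_eq Kf hcont hKH 0 hdet0).and (eventually_posIndex_ge Kf hcont hKH 0)
  rw [Metric.eventually_nhds_iff] at hev
  obtain ⟨ε, hε, hε'⟩ := hev
  refine ⟨(ε⁻¹) ^ 2 + 1, by positivity, fun x hx => ?_⟩
  have hxpos : 0 < x := lt_of_lt_of_le (by positivity) hx
  set s : ℝ := (Real.sqrt x)⁻¹ with hsdef
  have hsqrt : ε⁻¹ < Real.sqrt x := by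
    calc ε⁻¹ = Real.sqrt ((ε⁻¹) ^ 2) := by rw [Real.sqrt_sq (by positivity)]
      _ < Real.sqrt x := Real.sqrt_lt_sqrt (by positivity) (by linarith)
  have hspos : 0 < s := inv_pos.2 (Real.sqrt_pos.2 hxpos)
  have hsε : s < ε := by
    rw [hsdef]
    calc (Real.sqrt x)⁻¹ < (ε⁻¹)⁻¹ := inv_strictAnti₀ (by positivity) hsqrt
      _ = ε := inv_inv ε
  obtain ⟨hνK, hπK⟩ := hε' (y := s) (by rw [Real.dist_eq, sub_zero, abs_of_pos hspos]; exact hsε)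
  have hcntK := (negIndex_add_posIndex_add_corank (hKH s)).1
  have hπK' : Fintype.card {j // 0 < (hKH s).eigenvalues j} = Fintype.card {j // 0 < (hKH 0).eigenvalues j} := by omega
  -- hermitian witnesses
  have hG : (𝔾[s]).IsHermitian := isHermitian_pencil (fun l => 2 * (d l₁ - d l)) S hSs s
  have hGs : (𝔾[s]).IsSymm := Matrix.isHermitian_iff_isSymm.1 hG
  have hM : ((𝕌₁)ᵀ * 𝔾[s] * 𝕌₁).IsHermitian := isHermitian_of_isSymm (GramDual.isSymm_conj hGs _)
  -- `K(s)` and `M(s) = UᵀG(s)U` have the same indices (diagonal congruence)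
  have hKeq := K_eq_conj d S hS l₁ l₂ h12 hsec hspos.ne'
  have hMeq := conj_eq_K d S hS l₁ l₂ h12 hsec hspos.ne'
  have hB : ((Matrix.diagonal (fun i => (s ^ (if λ₁ i = 0 then 𝕘 else 0))⁻¹))ᵀ * ((𝕌₁)ᵀ * 𝔾[s] * 𝕌₁)
      * Matrix.diagonal (fun i => (s ^ (if λ₁ i = 0 then 𝕘 else 0))⁻¹)).IsHermitian := by
    rw [Matrix.diagonal_transpose, ← hKeq]; exact hKH s
  have hinv : (Matrix.diagonal (fun i => s ^ (if λ₁ i = 0 then 𝕘 else 0)))ᵀ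
      * ((Matrix.diagonal (fun i => (s ^ (if λ₁ i = 0 then 𝕘 else 0))⁻¹))ᵀ * ((𝕌₁)ᵀ * 𝔾[s] * 𝕌₁)
        * Matrix.diagonal (fun i => (s ^ (if λ₁ i = 0 then 𝕘 else 0))⁻¹))
      * Matrix.diagonal (fun i => s ^ (if λ₁ i = 0 then 𝕘 else 0)) = (𝕌₁)ᵀ * 𝔾[s] * 𝕌₁ := by
    rw [Matrix.diagonal_transpose, Matrix.diagonal_transpose, ← hKeq]; exact hMeq.symm
  obtain ⟨hνKM, hπKM⟩ := indices_conj_eq hM _ _ hB hinv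
  have hνBK : Fintype.card {j // hB.eigenvalues j < 0} = Fintype.card {j // (hKH s).eigenvalues j < 0} :=
    negIndex_congr hB (hKH s) (by rw [Matrix.diagonal_transpose, ← hKeq])
  have hπBK : Fintype.card {j // 0 < hB.eigenvalues j} = Fintype.card {j // 0 < (hKH s).eigenvalues j} :=
    posIndex_congr hB (hKH s) (by rw [Matrix.diagonal_transpose, ← hKeq])
  -- `M(s)` and `G(s)` have the same indices (orthogonal congruence)
  have hinv2 : ((𝕌₁)ᵀ)ᵀ * ((𝕌₁)ᵀ * 𝔾[s] * 𝕌₁) * (𝕌₁)ᵀ = 𝔾[s] := by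
    have h1 := eigU_mul_transpose_self S hS l₁
    rw [Matrix.transpose_transpose]
    calc 𝕌₁ * ((𝕌₁)ᵀ * 𝔾[s] * 𝕌₁) * (𝕌₁)ᵀ = (𝕌₁ * (𝕌₁)ᵀ) * 𝔾[s] * (𝕌₁ * (𝕌₁)ᵀ) := by
          simp only [Matrix.mul_assoc]
      _ = 𝔾[s] := by rw [h1, Matrix.one_mul, Matrix.mul_one]
  obtain ⟨hνGM, hπGM⟩ := indices_conj_eq hG _ _ hM hinv2
  -- `G(s) = x^{−d_{l₁}} F(x)`
  have hGF := rescaledPencil_eq_smul d S l₁ hle hxpos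
  have hF := isHermitian_pencil d S hSs x
  have hcF : ((x ^ d l₁)⁻¹ • ∑ l, x ^ d l • S l).IsHermitian := by rw [← hGF]; exact hG
  have hνGF : Fintype.card {j // hG.eigenvalues j < 0} = Fintype.card {j // hF.eigenvalues j < 0} := by
    rw [negIndex_congr hG hcF hGF, negIndex_smul_pos hF (inv_pos.2 (pow_pos hxpos _)) hcF]
  have hπGF : Fintype.card {j // 0 < hG.eigenvalues j} = Fintype.card {j // 0 < hF.eigenvalues j} := by
    rw [posIndex_congr hG hcF hGF, posIndex_smul_pos hF (inv_pos.2 (pow_pos hxpos _)) hcF]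
  -- assemble
  have hνF : Fintype.card {j // hF.eigenvalues j < 0}
      = Fintype.card {j // (hS l₁).eigenvalues j < 0} + Fintype.card {j // (isHermitian_compression S hS l₁ l₂).eigenvalues j < 0} := by
    rw [← hνGF, ← hνGM, ← hνKM, hνBK, hνK, hν0]
  have hπF : Fintype.card {j // 0 < hF.eigenvalues j}
      = Fintype.card {j // 0 < (hS l₁).eigenvalues j} + Fintype.card {j // 0 < (isHermitian_compression S hS l₁ l₂).eigenvalues j} := by
    rw [← hπGF, ← hπGM, ← hπKM, hπBK, hπK', hπ0]
  refine ⟨hνF, hπF, det_ne_zero_of_indices hF ?_⟩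
  rw [hνF, hπF, ← hν0, ← hπ0, Fintype.card_fin]
  have := hcnt0
  rw [Fintype.card_fin] at this
  exact this

end FlagTwoStep

end Inertia

end Summit.ValiantsHypothesis.ValiantsHypothesis.Theorems.LacunarySymmetroidMatrixDescartes

/-! ## §5  The two-step flag at `0⁺` (appended; reflected exponents) -/

namespace Summit.ValiantsHypothesis.ValiantsHypothesis.Theorems.LacunarySymmetroidMatrixDescartes

open Polynomial Matrix Finset
open scoped BigOperators Topology

namespace Inertia

section FlagTwoStepZero

variable {m K : ℕ} (d : Fin K → ℕ) (S : Fin K → Matrix (Fin m) (Fin m) ℝ) (hS : ∀ l, (S l).IsHermitian) (l₁ l₂ : Fin K)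

/-- the eigenvector matrix of the bottom letter (file-local notation) -/
local notation3 (prettyPrint := false) "𝕌₁" => ((hS l₁).eigenvectorUnitary : Matrix (Fin m) (Fin m) ℝ)

/-- the eigenvalues of the bottom letter (file-local notation) -/
local notation3 (prettyPrint := false) "λ₁" => (hS l₁).eigenvalues

/-- the compression of `S_{l₂}` to `ker S_{l₁}` in the eigenbasis (file-local notation) -/
local notation3 (prettyPrint := false) "𝔻" =>
  (((𝕌₁)ᵀ * S l₂ * 𝕌₁).submatrix (fun i : {i : Fin m // λ₁ i = 0} => i.1) (fun i : {i : Fin m // λ₁ i = 0} => i.1))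

/-- **THE TWO-STEP FLAG AT `0⁺`.**  Real symmetric letters, unique BOTTOM exponent `d_{l₁}` (`S_{l₁}` possibly singular),
unique second-lowest exponent `d_{l₂}` (all other exponents `> d_{l₂}`), and the compression `D` of `S_{l₂}` to `ker S_{l₁}`
non-singular.  Then for all small `x > 0`: `ν(F(x)) = ν(S_{l₁}) + ν(D)`, `π(F(x)) = π(S_{l₁}) + π(D)`, `det F(x) ≠ 0`
(the flag at infinity for the reflected exponents `T − d_l`, through `F(x) = x^T · Σ_l (1/x)^{T − d_l} S_l`). [folklore] -/
theorem flag_twoStep_indices_eq_zero (h12 : d l₁ < d l₂) (hsec : ∀ l, l ≠ l₁ → l ≠ l₂ → d l₂ < d l)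
    (hDu : IsUnit (𝔻).det) (hSs : ∀ l, (S l).IsSymm) :
    ∃ ε : ℝ, 0 < ε ∧ ∀ x : ℝ, 0 < x → x < ε →
      Fintype.card {j // (isHermitian_pencil d S hSs x).eigenvalues j < 0}
          = Fintype.card {j // (hS l₁).eigenvalues j < 0} + Fintype.card {j // (isHermitian_compression S hS l₁ l₂).eigenvalues j < 0}
        ∧ Fintype.card {j // 0 < (isHermitian_pencil d S hSs x).eigenvalues j}
          = Fintype.card {j // 0 < (hS l₁).eigenvalues j} + Fintype.card {j // 0 < (isHermitian_compression S hS l₁ l₂).eigenvalues j}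
        ∧ (∑ l, x ^ d l • S l).det ≠ 0 := by
  classical
  -- reflected exponents `e l = T − d l`, `T = Σ d`
  set T : ℕ := ∑ l, d l with hT
  have hle : ∀ l, d l ≤ T := fun l => Finset.single_le_sum (f := d) (fun i _ => Nat.zero_le _) (Finset.mem_univ l)
  set e : Fin K → ℕ := fun l => T - d l with he
  have h12' : e l₂ < e l₁ := by have := hle l₁; have := hle l₂; simp only [he]; omega
  have hsec' : ∀ l, l ≠ l₁ → l ≠ l₂ → e l < e l₂ := by
    intro l hl1 hl2; have := hsec l hl1 hl2; have := hle l; have := hle l₂; simp only [he]; omega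
  obtain ⟨N, hN, hN'⟩ := flag_twoStep_indices_eq e S hS l₁ l₂ h12' hsec' hDu hSs
  refine ⟨N⁻¹, inv_pos.2 hN, fun x hx hxε => ?_⟩
  have hy : N ≤ x⁻¹ := by
    have h := (lt_inv_comm₀ hx hN).1 hxε
    exact h.le
  obtain ⟨h1, h2, h3⟩ := hN' x⁻¹ hy
  -- `F(x) = x^T • H(1/x)`
  have hscale : (∑ l, x ^ d l • S l) = x ^ T • ∑ l, x⁻¹ ^ e l • S l := by
    rw [Finset.smul_sum]
    refine Finset.sum_congr rfl fun l _ => ?_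
    rw [smul_smul]
    congr 1
    have hsplit : x ^ T = x ^ d l * x ^ e l := by rw [← pow_add]; congr 1; simp only [he]; have := hle l; omega
    rw [hsplit, mul_assoc, ← mul_pow, mul_inv_cancel₀ hx.ne', one_pow, mul_one]
  have hc : 0 < x ^ T := pow_pos hx _
  have hHx : (∑ l, x⁻¹ ^ e l • S l).IsHermitian := isHermitian_pencil e S hSs x⁻¹
  have hcH : (x ^ T • ∑ l, x⁻¹ ^ e l • S l).IsHermitian := by rw [← hscale]; exact isHermitian_pencil d S hSs x
  refine ⟨?_, ?_, ?_⟩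
  · rw [negIndex_congr (isHermitian_pencil d S hSs x) hcH hscale, negIndex_smul_pos hHx hc hcH]
    exact h1
  · rw [posIndex_congr (isHermitian_pencil d S hSs x) hcH hscale, posIndex_smul_pos hHx hc hcH]
    exact h2
  · rw [hscale, Matrix.det_smul]
    exact mul_ne_zero (pow_ne_zero _ hc.ne') h3

end FlagTwoStepZero

end Inertia

end Summit.ValiantsHypothesis.ValiantsHypothesis.Theorems.LacunarySymmetroidMatrixDescartes
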